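import Mathlib
import HarnessLib
import HarnessLib.Audit
import Summits.HodgeConjecture.Statement
import Summits.HodgeConjecture.HodgeConjecture.Theorems.WeilTypeLadderSimilarReach
import Summits.HodgeConjecture.HodgeConjecture.Theorems.BlochSeedDiscThreeLiftableDoor
import HarnessLib.Audit.Status.Attr

/-!
Route: DoublyPolarisedTransport

# Route DoublyPolarisedTransport — Liftable carriers at doubly-polarised members transport Markman's
floor to every discriminant cell

It suffices to show X = X1 ∧ X2 (a LINE for rung H2 = `SevenfoldWeilCensus.WeilSixfolds`, HC for
every ℚ(√-d)-Weil-type abelian sixfold, all d and all discriminant cells; no summit and no rung is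
proved by filing it). Call a polarised Weil sixfold (P, ψ₀, h) DOUBLY POLARISED if P carries a
SECOND K-symmetrised polarisation class h′ = d·e′*a′ + ψ₀*e′*a′ for which (P, ψ₀, h′) lies in
Markman's hyperbolic (split) component while (P, ψ₀, h) does not. X2 (DoublyPolarisedSimilarAnchors,
anchor supply): every non-hyperbolic target (A, φ) carrying a non-zero rational (3,3) Weil class is
Weil-similar (Deligne's rational-Gram matching `IsWeilSimilar`) to a doubly-polarised (P, ψ₀, h)
carrying a non-zero rational (3,3) Weil class w. X1 (DoublyPolarisedLiftableCarriers, the research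
crux): at every doubly-polarised member the class q·h³ + w (some q ∈ ℚ) is carried by an INTEGRAL
closed codimension-3 subscheme Z ⊂ P that LIFTS étale-locally along every Weil-type family through P
on which the class stays Hodge (`LiftsAlongWeilFamilies 6 3 d P Z κ`). Restrict-then-tighten: the
restricted class is the hyperbolic component (Markman's theorem, imported by name as
HyperbolicFloor); the widening runs through the members the hyperbolic component SHARES with every
other cell.
Lean: `DoublyPolarisedLiftableCarriers ∧ DoublyPolarisedSimilarAnchors`

## Assembly
Pure logic over two tree doors: for each d > 0 and each non-hyperbolic target,
DoublyPolarisedSimilarAnchors supplies the doubly-polarised Weil-similar anchor (P, ψ₀, e, a, w; e′,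
a′); DoublyPolarisedLiftableCarriers supplies (Z, κ, q) with `LiftsAlongWeilFamilies`; door L
`BlochSeedDiscThree.weilAnchorLocalClause_of_liftsAlongWeilFamilies` (with FlatClassSpecialises)
gives `WeilAnchorLocalClause 3 d P h w`, hence `HasSimilarLocallyAlgebraicWeilAnchorsAwayFromSplit 3
d`; door B′ `WeilTypeLadder.weilSixfolds_of_floor_of_reachSimilar_of_similarAnchorsAwayFromSplit`
(with HyperbolicFloor, SimilarReach) gives the rung. The deciding theorem `closes` (glue.lean) is
this argument, kernel-checked (Sketch.lean rc 0, 0 sorry).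

CLOSES_TARGET: closes rung H2 of HodgeConjecture: Summit.HodgeConjecture.HodgeConjecture.Theses.SevenfoldWeilCensus.WeilSixfolds (D-0061; not the summit Statement) — the deciding theorem of this route concludes that registered leaf instead of the Statement decl `HodgeConjecture` (class rung: servable and labelled, never counted as concluding the summit Statement).

Rationale: WHY THIS LINE. Mechanism: (i) odd-rank product members P = E_K × A′₅ and B₃ × B′₃ (and the CM tensor
point) carry product polarisations a·θ₁ + b·θ₂ whose discriminant a·b³·δ₁δ₂ (resp. a³b³δ₁δ₂) runs
through EVERY class of ℚ^×/Nm(K^×) as (a, b) varies (Landherr1936HermitianForms;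
vanGeemen1994HodgeAV 5.2–5.11), so each such P is simultaneously a member of the hyperbolic cell
(for one weight) and of any prescribed non-hyperbolic cell (for another) — a 6-dimensional shared
locus, present for every d, not a CM point; (ii) on P the Weil class w is ALGEBRAIC
(HyperbolicFloor: Markman2025SecantWeil via the hyperbolic polarisation h′, reach
Deligne1982HodgeCycles Thm 4.8) — so at the anchor the class to be moved is already represented by
cycles, and the only missing input is a representative of q·h³ + w that lifts along the h-cell;
(iii) door L of the tree (`BlochSeedDiscThree.weilAnchorLocalClause_of_liftsAlongWeilFamilies`,
Artin1969 + FlatClassSpecialises) turns a liftable integral carrier into the local clause, door B′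
(`WeilTypeLadder.weilSixfolds_of_floor_of_reachSimilar_of_similarAnchorsAwayFromSplit`,
SimilarReach) spreads it over the cell. Imported from deformation theory: liftability (weaker than
Bloch1972Semiregularity / BuchweitzFlenner2003 semiregularity — any pro-representable-hull argument,
T¹-lifting, or p-adic lifting may discharge it). What prior routes do not do: EightfoldBlochSeeds /
FirstOrderSemiregularSeeds / the registered H2 line perry-cm-tower-all-d put DESIGNED semiregular
objects at CM or eightfold anchors (census: 218 rows, 0 candidates); BiquadraticSecantLift changes
the field; SevenfoldWeilCensus reduces to split members. Here the object SOURCE is Markman's proved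
cycle on the shared member, re-polarised (elementary modification along the second polarisation),
and the condition asked is liftability, not injectivity of a semiregularity map. Nearest print:
arXiv:2603.20268 (Mostaed 2026) isolates exactly the «criterion valid for all discriminants
simultaneously» as the missing input (his Thm 7, p. 5); this line proposes the shared-member
transport as that criterion. STRENGTH (J r1 F2): X1 is typed with the STRONG étale-local reading —
the same closed SUBSCHEME Z ⊂ P lifts flatly over an étale neighbourhood in every polarised Weil
family through (P, h) (`LiftsAlongWeilFamilies`); this is strictly skew to H2 (HC ⇏ X1 as typed: HC
gives some cycle on each fibre, not a flat lift of this Z) and it is refutable member-wise by one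
`WeilRigidObstructed` theorem; the on-path weakening (local clause at the anchor, HC ⇒ it) is filed
separately as route RealMultiplicationPencil X1′ (seat hodge-idea-1 g3). REV 3 (director R12.9a,
2026-08-28T02:04:50Z): door-B/RM variant folded in as the ASIDE item RMAnchorLocalClause
(stmt-HodgeConjecture-24412, from the superseded route RealMultiplicationPencil; critic REQUESTS
l.23691 + addendum 02:04:10Z; instrument I-a = W-FREE, evidence I-a-RMPencil.md on 24412:
class-level retuning by line-bundle twists of one Markman sheaf is free, so RM is inessential at
class level; the burden = instruments I-b/I-c (a NON-SPLIT glued representative of twists of one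
Markman sheaf, Buchweitz–Flenner/G-equivariantly semiregular at a CM member) is shared with door L;
the only RM-specific lever question = does End⁰ = L kill cross-Ext terms at I-b/I-c — a
representation-theoretic check at one CM point, a census row, not a route). RM anchors (X2′
RMSimilarAnchors, stmt-HodgeConjecture-24413) stay recorded as the second anchor class under
DoublyPolarisedSimilarAnchors (evidence note-24413-into-23603.md).

RANKED CRUXES. #2 DoublyPolarisedLiftableCarriers (crux) — For every d > 0 and every
doubly-polarised ℚ(√-d)-Weil sixfold (P, ψ₀; h non-hyperbolic, h′ hyperbolic) with a non-zero
rational (3,3) Weil class w, some class q·h³ + w (q ∈ ℚ) is supported on an integral closed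
subscheme Z ⊂ P of codimension 3 that lifts étale-locally along every Weil-type family through P on
which the class stays Hodge. bears_on: rung H2 (LADDER-HodgeAV). Instrument row that refutes it: the
first-order cross-obstruction of the elementary modification of Markman's secant object along an
A′-fibre divisor at the CM (1,5)-product E_K × E_K⁵ (HSemireg design-row machinery, anchor class
«doubly polarised», object «repolarised secant») — a non-zero obstruction class in every direction
of the h-cell transverse to the h′-cell kills the mechanism (not the statement). [difficulty:
open-problem] (why it might fail: WeilRigidObstructed may hold at every carrier: Markman's object is
semiregular only for h′; along h-directions transverse to the hyperbolic cell no lifting principle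
is known, and Voisin/Zucker forbid representatives that lift in all 18 unpolarised directions.)
[Markman2025SecantWeil, Bloch1972Semiregularity, BuchweitzFlenner2003, Artin1969, arXiv:2603.20268]
#3 DoublyPolarisedSimilarAnchors (crux) — For every d > 0, every ℚ(√-d)-Weil sixfold (A, φ) that is
non-hyperbolic for all its K-symmetrised polarisation classes and carries a non-zero rational (3,3)
Weil class is Weil-similar (`IsWeilSimilar`: matching rational Gram data) to a doubly-polarised (P,
ψ₀, h) — h non-hyperbolic, some h′ on the same (P, ψ₀) hyperbolic — carrying a non-zero rational
(3,3) Weil class. Witnesses: weighted product polarisations on E_K × A′₅, B₃ × B′₃, E_K³ × Ē_K³.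
[difficulty: M] (why it might fail: IsWeilSimilar asks for the target's full rational similarity
class incl. multiplier, not only the discriminant; weighted product forms ⟨a⟩ ⊥ b·H′ might miss a
similarity class when H′ is constrained to odd-rank Weil factors.) [Landherr1936HermitianForms,
vanGeemen1994HodgeAV, Deligne1982HodgeCycles]
#5 HyperbolicFloor (crux) — Named fact (unrefereed preprint, imported by name, never proved here):
Markman's theorem — rational (3,3) Weil classes on hyperbolic ℚ(√-d)-Weil sixfolds are algebraic.
Crux-kind only because every binder of the deciding theorem must be an item. [difficulty:
open-problem] (why it might fail: the preprint (arXiv:2509.23403 survey of the secant construction)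
is unrefereed; a gap in the Ḡ-descent for q = 3 would remove the floor for all lines on H2 at once.)
[Markman2025SecantWeil]
#6 SimilarReach (crux) — Named refereed fact, imported by name: Deligne's reach by similitude — two
polarised Weil-type abelian varieties with similar rational Hermitian data lie in one connected
Weil-type family (Mumford 1969 families; Deligne 1982 proof of Thm 4.8). [difficulty: provable-now]
(why it might fail: only if the tree's typing of IsWeilSimilar is stronger than Deligne's hypothesis
(matrix form with a common multiplier); then the fact as typed is not the published one.)
[Deligne1982HodgeCycles, vanGeemen1994HodgeAV]
#7 FlatClassSpecialises (crux) — Named textbook fact, imported by name: the fibre classes of a flat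
family of closed subschemes of a smooth projective family are the restrictions of one class (Fulton
1998 §10.1 / Voisin II §9.2); consumed by door L. [difficulty: provable-now] (why it might fail:
only a typing risk: the tree's def quantifies over SchemeOver ℂ families with a smoothness
hypothesis on the base; a mismatch with door L's use would surface as a type error, not a
mathematical gap.) [VoisinHodgeII2003, BuchweitzFlenner2003]

TWO-LAYER PLAN. DoublyPolarisedLiftableCarriers ⇐ (C1) RepolarisedSecantCarrier: at P = E_K × A′₅
(resp. B₃ × B′₃) the specialised secant cycle admits an elementary modification along fibre divisors
with class q·h³ + w and integral support → (C2) TransverseLift: that carrier satisfies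
LiftsAlongWeilFamilies (pro-representable hull unobstructed in the h-cell directions) →
DoublyPolarisedLiftableCarriers. DoublyPolarisedSimilarAnchors ⇐ (S1) weighted-product Gram
realisation (Landherr) → (S2) IsWeilSimilar bookkeeping.

KILL CRITERIA. Refuted outright (close --reason refuted:DoublyPolarisedLiftableCarriers) by a
theorem `WeilRigidObstructed 6 3 d P Z κ` for every integral carrier of every class q·h³ + w at one
doubly-polarised (P, ψ₀, h) (the tree's disjunction BlochSeedDiscThreeLiftableDoor:171 makes this
the exact negation at that anchor). Pivot (not death) if only the repolarised-secant carrier is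
obstructed: other carriers at the same anchors. Mooted if HSemireg's perry-cm-tower-all-d or
EightfoldBlochSeeds closes H2 first. DoublyPolarisedSimilarAnchors refuted for one (d, similarity
class) ⇒ replace the anchor family (B₃ × B′₃ weights) before closing.

NOT DECOMPOSED YET. The carrier construction (which modification of which specialisation of
Markman's object), the integrality of its support, and the choice among lifting engines (Bloch/BF
semiregularity for the new polarisation, T¹-lifting, Pridham's derived criterion) are deliberately
not items: they are layer-2 children of DoublyPolarisedLiftableCarriers once a prover picks the
anchor family. Constants (weights a, b realising each class) are bookkeeping under
DoublyPolarisedSimilarAnchors.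

CHEAPEST FALSIFIER. At the CM doubly-polarised point P = E_K³ × Ē_K³ (weights (1, b)), compute the
first-order obstruction of the secant-type cycle class q·h_b³ + w in the h_b-cell directions
transverse to the h_1-cell: this is finite K-linear algebra of the HSemireg design-row kind (cup
product H¹(T_P)_{h_b-polarised} ⊗ H¹(N_Z) → H²(N_Z) on an explicit CM sixfold). A non-vanishing
obstruction for every carrier class in ℚh_b³ + w at that point does NOT refute the crux (other
doubly-polarised members remain) but prices it; vanishing there is the first rung. Not run this
session (no engine in this seat; the HSemireg census scripts are the instrument). PRE-FILTERS (J r1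
F4, director R12.5; CORRECTED rev 6 after critic REQUESTS l.25390 and the crux idea
«kleiman-degeneracy-carriers», evidence #4/#5 on stmt-HodgeConjecture-23602): Kleiman's smoothing
WITH RATIONAL COEFFICIENTS HOLDS at (n, d) = (6, 3) — his range is d < n/2 + 1 [arXiv:2407.04000 p.6
L9; Kleiman 1969 §5; Fulton, Intersection Theory, Ex. 15.3.2: 2α = c₃(E) − n·h³ with c₁(E), c₂(E) ∝
h, h², E(−h) globally generated, rank E ≤ 6], and the top degeneracy locus of general sections of
such an E is smooth (next determinantal stratum has codimension 8 > 6, Kleiman–Bertini) and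
connected (Fulton–Lazarsfeld, E ample), so 2w + n·h³ is the class of ONE integral smooth threefold
at every doubly-polarised anchor (w is algebraic there by HyperbolicFloor): the support clause of X1
is free, and liftability may be argued for a smooth carrier, which moves at least as far as the pair
(E, sections) does — the research content of X1 is that liftability alone. What fails at the
boundary is only INTEGRAL-coefficient smoothing (Kollár–Voisin Whitney range d < n/2; Benoist Thm 25
/ Prop 26, ℤ-parity obstructions [arXiv:2407.04000 p.5 L45]), which X1 (q ∈ ℚ; `classesSupportedOn`
is a linear subspace) never needs; Yang (arXiv:1708.02722) gives the pro-representable-hull form of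
the lifting question used in C2. CHERN PERSISTENCE (memo N6, MEMO-design-row-23602-v2.md sha16
01dd3334950bd18d): any carrier whose fundamental class is a polynomial in divisor classes of P
(products, reweighted diagonals, divisor intersections) has class in the Lefschetz part and cannot
carry w; a carrier of q·h³ + w must keep that class Hodge along the whole non-split h-cell, which
already excludes every divisor-built and every T¹-rigid union (census T2(ii), critic STRIKE on
SquareNodalUnions) — provers start from Markman's secant cycle re-polarised, not from products.

NUMBERS. dim of each polarised √-d sixfold cell: 9; shared (1,5)-product locus: 0 + 6 = 6 (E_K
rigid, A′₅ of signature (1,4) or (2,3): 1·4 = 4 or 2·3 = 6); shared (3,3)-product locus B₃ × B′₃: 2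
+ 2 = 4; discriminant classes ℚ^×/Nm(ℚ(√-d)^×): infinitely many, all realised by weights (Landherr).
HSemireg census at CM anchors: 218 design rows, 0 semiregular Weil-bearing candidates
(STRATEGY-CENSUS.md of crux WeilSixfolds).

DEFINITION REQUESTS. None: every notion is in the tree (IsHyperbolicWeilType, IsWeilSimilar,
LiftsAlongWeilFamilies, classesSupportedOn, cupPowTwo).

Novelty: Searches (2026-08-27): lit search --hybrid "abelian variety of Weil type discriminant two
polarizations split component deformation of algebraic cycle semiregular" (8 docs: Deligne1982 pp
12,61,157; Green–Murre–Voisin 1994 pp 219–234; van Geemen in LNM; none on shared members); lit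
vsearch "<member of split component also on non-split component; transport secant class to other
polarization>" (8 docs, nearest Deligne1982 p 165, Carlson–Müller-Stach–Peters p 364 — period-domain
generalities); lit search --source all "Weil type hyperbolic discriminant sixfold algebraic" (1
local + 7 remote: arXiv:2603.20268 Mostaed 2026 the only relevant); lit galaxy search "Weil
type|secant sheaf|semiregular|semi-regularity" --star all (24 rows, 0 relevant), --star pdf "abelian
varieties of Weil type|secant sheaves" (0), "Weil type" (8, 0 relevant); ledger negatives --problem
HodgeConjecture (6 refuted, none on Weil anchors); tree: rg IsHyperbolicWeilType /
HasSimilarLocallyAlgebraicWeilAnchorsAwayFromSplit / LiftsAlongWeilFamilies (doors L, B′ exist; no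
route or line quantifies over members carrying two polarisation classes of different split type).
Nearest prior art found: Markman2025SecantWeil (hyperbolic component only; his §12 asks for other
components via weaker semiregularity, = FirstOrderSemiregularSeeds); Schoen1998HodgeWeilAddendum
(special sixfolds, d = 3); arXiv:2603.20268 (names the all-discriminant criterion as missing, proves
none); in-tree STRATEGY-CENSUS T2 «product-anchor vari  [refs: 2603.20268, Deligne1982]

Barriers (technique_class: variational-hodge, liftable-carrier, doubly-polarised-anchor): - technique_class: variational-hodge, liftable-carrier, doubly-polarised-anchor
- Literature.Barriers.HodgeConjecture.CattaniDeligneKaplan1995_hodgeLocus_algebraicFor: used, not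
fought — the h-cell through P on which q·h³ + w stays Hodge is an algebraic (Noether–Lefschetz /
Shimura) locus, and liftability is asked exactly over it; the Voisin 2002 / Zucker obstruction (no
coherent sheaves or cycles deforming over the 18-dimensional unpolarised family, tree files
KaehlerCoherentSheaves*, KaehlerCounterexamples*) is evaded because every family is a POLARISED
Weil-type abelian scheme (IsWeilTypeFamily) with projective fibres and the carrier is a subscheme of
projective P.
- Literature.Barriers.HodgeConjecture.Andre1996_hodgeClassesOnAbelianVarieties_motivated: outside
its class — no motivated-cycle / Lefschetz-standard-conjecture transport is invoked (that is route
b05 territory); the output here is an honest algebraic cycle obtained by Artin algebraisation of a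
formal lift (door L), so «motivated but not known algebraic» never arises.
- HSemireg census T2 (i) tensor-rank / (ii) ⊕-obstruction-kernel at product anchors: the carrier is
required INTEGRAL (AlgebraicGeometry.IsIntegral Z), i.e. not a box product or direct sum; the bet is
that a re-polarised modification of the (irreducible) secant cycle stays outside the ⊕-kernel
mechanism.
- Negatives index: the 6 refuted HodgeConjecture statements (SparseFermat, MilnorK, So7 theta,
MirrorBraneLift tropical, DerivedTorelliFermat, ELi

sub-problem: HodgeConjecture · status: open · opened planner-hodge-idea-1-g2-0 2026-08-27T23:23:49Z · rev 6 · ledger route-HodgeConjecture-DoublyPolarisedTransport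
GENERATED by the gate from the ledger (D-0016/17). Provers cite these decls: `theorem foo : Summit.HodgeConjecture.HodgeConjecture.Theses.DoublyPolarisedTransport.<Decl> := …` in Summits/HodgeConjecture/HodgeConjecture/Theorems/<Name>.lean.
-/

namespace Summit.HodgeConjecture.HodgeConjecture.Theses.DoublyPolarisedTransport

open scoped BigOperators Topology Manifold Classical MeasureTheory ProbabilityTheory Matrix InnerProductSpace ComplexConjugate ContinuousMap
open Filter Set Function TopologicalSpace MeasureTheory

attribute [summit_statement] _root_.HodgeConjecture
attribute [summit_statement] _root_.Summit.HodgeConjecture.HodgeConjecture.Theses.SevenfoldWeilCensus.WeilSixfolds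

/-- item stmt-HodgeConjecture-23602 · crux · rank 2 · open · by planner
why it might fail: Chern persistence (memo N6): a subscheme carrier of q·h³+w at a doubly-polarised member must keep its class Hodge along the non-split h-cell; divisor/product-built carriers cannot, and T¹-rigid ones fall to census T2(ii).
sources: arXiv:2502.03415, Bloch1972, arXiv:2407.04000
[crux] For every d > 0 and every doubly-polarised ℚ(√-d)-Weil sixfold (P, ψ₀; h non-hyperbolic, h′
hyperbolic) with a non-zero rational (3,3) Weil class w, some class q·h³ + w (q ∈ ℚ) is supported on
an integral closed subscheme Z ⊂ P of codimension 3 that lifts étale-locally along every Weil-type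
family through P on which the class stays Hodge. bears_on: rung H2 (LADDER-HodgeAV). Instrument row
that refutes it: the first-order cross-obstruction of the elementary modification of Markman's
secant object along an A′-fibre divisor at the CM (1,5)-product E_K × E_K⁵ (HSemireg design-row
machinery, anchor class «doubly polarised», object «repolarised secant») — a non-zero obstruction
class in every direction of the h-cell transverse to the h′-cell kills the mechanism (not the
statement). [difficulty: open-problem] -/
@[route_item "route-HodgeConjecture-DoublyPolarisedTransport", crux]
def DoublyPolarisedLiftableCarriers : Prop :=
  ∀ d : ℕ, 0 < d → ∀ (P : Literature.AlgebraicGeometry.Motives.AbelianVariety ℂ) (ψ₀ : P ⟶ P) (e e' : Literature.AlgebraicGeometry.Motives.ProjectiveEmbedding P.X) (a : Literature.AlgebraicGeometry.HodgeTheory.complexBetti (Literature.AlgebraicGeometry.Motives.projectiveSpace e.n ℂ) 2) (a' : Literature.AlgebraicGeometry.HodgeTheory.complexBetti (Literature.AlgebraicGeometry.Motives.projectiveSpace e'.n ℂ) 2) (w : Literature.AlgebraicGeometry.HodgeTheory.complexBetti P.X (2 * 3)), P.dim = 2 * 3 → CategoryTheory.CategoryStruct.comp ψ₀ ψ₀ =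 -(d • CategoryTheory.CategoryStruct.id P) → Literature.AlgebraicGeometry.HodgeTheory.IsRationalClass a → a ≠ 0 → Literature.AlgebraicGeometry.HodgeTheory.IsRationalClass a' → a' ≠ 0 → w ∈ Literature.AlgebraicGeometry.HodgeTheory.weilClassesOf P ψ₀ 3 d → Literature.AlgebraicGeometry.HodgeTheory.IsRationalClass w → w ≠ 0 → Literature.AlgebraicGeometry.HodgeTheory.IsOfHodgeType (2 * 3) P.X (2 * 3) 3 3 w → Literature.AlgebraicGeometry.Motives.IsHyperbolicWeilType P ψ₀ 3 ((d : ℂ) • Literature.AlgebraicGeometry.HodgeTheory.complexBetti.map e'.ι 2 a' + Literature.AlgebraicGeometry.HodgeTheory.complexBetti.map ψ₀.hom.hom.hom 2 (Literature.AlgebraicGeometry.HodgeTheory.complexBetti.map e'.ι 2 a')) → ¬ Literature.AlgebraicGeometry.Motives.IsHyperbolicWeilType P ψ₀ 3 ((d : ℂ) • Literature.AlgebraicGeometry.HodgeTheory.complexBetti.map e.ι 2 a + Literature.AlgebraicGeometry.HodgeTheory.complexBetti.map ψ₀.hom.hom.hom 2 (Literature.AlgebraicGeometry.HodgeTheory.complexBetti.map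 e.ι 2 a)) → ∃ (Z : AlgebraicGeometry.Scheme.{0}) (κ : Z ⟶ P.X.left) (q : ℚ), AlgebraicGeometry.IsClosedImmersion κ ∧ AlgebraicGeometry.IsIntegral Z ∧ (∀ z ∈ Set.range κ.base, ((3 : ℕ) : ℕ∞) ≤ Order.coheight z) ∧ (∃ z : Z, Order.coheight (κ.base z) = ((3 : ℕ) : ℕ∞)) ∧ (((q : ℚ) : ℂ) • Literature.AlgebraicGeometry.HodgeTheory.cupPowTwo ((d : ℂ) • Literature.AlgebraicGeometry.HodgeTheory.complexBetti.map e.ι 2 a + Literature.AlgebraicGeometry.HodgeTheory.complexBetti.map ψ₀.hom.hom.hom 2 (Literature.AlgebraicGeometry.HodgeTheory.complexBetti.map e.ι 2 a)) 3 + w ∈ Literature.AlgebraicGeometry.HodgeTheory.classesSupportedOn P.X (Set.range κ.base) (2 * 3)) ∧ Literature.AlgebraicGeometry.HodgeTheory.LiftsAlongWeilFamilies (2 * 3) 3 d P Z κ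

/-- item stmt-HodgeConjecture-23603 · crux · rank 3 · closed · proved by Summit.HodgeConjecture.HodgeConjecture.Theses.DoublyPolarisedTransport.doublyPolarisedSimilarAnchors_holds (operator) · by planner
why it might fail: needs a member realising BOTH polarisation data by projective embeddings with IsWeilSimilar to the target; products/squares witnesses are census-dead for X1, simple RM members (LINE g3-1) are the intended supply.
sources: doi:10.2307/1970507, doi:10.1515/crll.1998.034
[crux] For every d > 0, every ℚ(√-d)-Weil sixfold (A, φ) that is non-hyperbolic for all its
K-symmetrised polarisation classes and carries a non-zero rational (3,3) Weil class is Weil-similar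
(`IsWeilSimilar`: matching rational Gram data) to a doubly-polarised (P, ψ₀, h) — h non-hyperbolic,
some h′ on the same (P, ψ₀) hyperbolic — carrying a non-zero rational (3,3) Weil class. Witnesses:
weighted product polarisations on E_K × A′₅, B₃ × B′₃, E_K³ × Ē_K³. [difficulty: M] -/
@[route_item "route-HodgeConjecture-DoublyPolarisedTransport", crux]
def DoublyPolarisedSimilarAnchors : Prop :=
  ∀ d : ℕ, 0 < d → ∀ (A : Literature.AlgebraicGeometry.Motives.AbelianVariety ℂ) (φ : A ⟶ A), A.dim = 2 * 3 → CategoryTheory.CategoryStruct.comp φ φ = -(d • CategoryTheory.CategoryStruct.id A) → (∀ (e : Literature.AlgebraicGeometry.Motives.ProjectiveEmbedding A.X) (a : Literature.AlgebraicGeometry.HodgeTheory.complexBetti (Literature.AlgebraicGeometry.Motives.projectiveSpace e.n ℂ) 2), Literature.AlgebraicGeometry.HodgeTheory.IsRationalClass a → a ≠ 0 → ¬ Literature.AlgebraicGeometry.Motives.IsHyperbolicWeilType A φ 3 ((d : ℂ) • Literature.AlgebraicGeometry.HodgeTheory.complexBetti.map e.ι 2 a + Literature.AlgebraicGeometry.HodgeTheory.complexBetti.map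 φ.hom.hom.hom 2 (Literature.AlgebraicGeometry.HodgeTheory.complexBetti.map e.ι 2 a))) → (∃ wA : Literature.AlgebraicGeometry.HodgeTheory.complexBetti A.X (2 * 3), wA ∈ Literature.AlgebraicGeometry.HodgeTheory.weilClassesOf A φ 3 d ∧ wA ≠ 0 ∧ Literature.AlgebraicGeometry.HodgeTheory.IsOfHodgeType (2 * 3) A.X (2 * 3) 3 3 wA) → ∃ (eA : Literature.AlgebraicGeometry.Motives.ProjectiveEmbedding A.X) (aA : Literature.AlgebraicGeometry.HodgeTheory.complexBetti (Literature.AlgebraicGeometry.Motives.projectiveSpace eA.n ℂ) 2) (P : Literature.AlgebraicGeometry.Motives.AbelianVariety ℂ) (ψ₀ : P ⟶ P) (e e' : Literature.AlgebraicGeometry.Motives.ProjectiveEmbedding P.X) (a : Literature.AlgebraicGeometry.HodgeTheory.complexBetti (Literature.AlgebraicGeometry.Motives.projectiveSpace e.n ℂ) 2) (a' : Literature.AlgebraicGeometry.HodgeTheory.complexBetti (Literature.AlgebraicGeometry.Motives.projectiveSpace e'.n ℂ) 2) (w : Literature.AlgebraicGeometry.HodgeTheory.complexBetti P.X (2 *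 3)), Literature.AlgebraicGeometry.HodgeTheory.IsRationalClass aA ∧ aA ≠ 0 ∧ P.dim = 2 * 3 ∧ CategoryTheory.CategoryStruct.comp ψ₀ ψ₀ = -(d • CategoryTheory.CategoryStruct.id P) ∧ Literature.AlgebraicGeometry.HodgeTheory.IsRationalClass a ∧ a ≠ 0 ∧ Literature.AlgebraicGeometry.HodgeTheory.IsRationalClass a' ∧ a' ≠ 0 ∧ w ∈ Literature.AlgebraicGeometry.HodgeTheory.weilClassesOf P ψ₀ 3 d ∧ Literature.AlgebraicGeometry.HodgeTheory.IsRationalClass w ∧ w ≠ 0 ∧ Literature.AlgebraicGeometry.HodgeTheory.IsOfHodgeType (2 * 3) P.X (2 * 3) 3 3 w ∧ Literature.AlgebraicGeometry.Motives.IsHyperbolicWeilType P ψ₀ 3 ((d : ℂ) • Literature.AlgebraicGeometry.HodgeTheory.complexBetti.map e'.ι 2 a' + Literature.AlgebraicGeometry.HodgeTheory.complexBetti.map ψ₀.hom.hom.hom 2 (Literature.AlgebraicGeometry.HodgeTheory.complexBetti.map e'.ι 2 a')) ∧ ¬ Literature.AlgebraicGeometry.Motives.IsHyperbolicWeilType P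 ψ₀ 3 ((d : ℂ) • Literature.AlgebraicGeometry.HodgeTheory.complexBetti.map e.ι 2 a + Literature.AlgebraicGeometry.HodgeTheory.complexBetti.map ψ₀.hom.hom.hom 2 (Literature.AlgebraicGeometry.HodgeTheory.complexBetti.map e.ι 2 a)) ∧ Literature.AlgebraicGeometry.Motives.IsWeilSimilar 3 P ψ₀ ((d : ℂ) • Literature.AlgebraicGeometry.HodgeTheory.complexBetti.map e.ι 2 a + Literature.AlgebraicGeometry.HodgeTheory.complexBetti.map ψ₀.hom.hom.hom 2 (Literature.AlgebraicGeometry.HodgeTheory.complexBetti.map e.ι 2 a)) A φ ((d : ℂ) • Literature.AlgebraicGeometry.HodgeTheory.complexBetti.map eA.ι 2 aA + Literature.AlgebraicGeometry.HodgeTheory.complexBetti.map φ.hom.hom.hom 2 (Literature.AlgebraicGeometry.HodgeTheory.complexBetti.map eA.ι 2 aA))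

-- `DoublyPolarisedSimilarAnchors` holds: proved by `Summit.HodgeConjecture.HodgeConjecture.Theses.DoublyPolarisedTransport.doublyPolarisedSimilarAnchors_holds` (its module imports this route file, so no `_holds` link can be stated here).

/-- item stmt-HodgeConjecture-23604 · support · rank 5 · open · by planner
why it might fail: the preprint (arXiv:2509.23403 survey of the secant construction) is unrefereed; a gap in the Ḡ-descent for q = 3 would remove the floor for all lines on H2 at once.
sources: arXiv:2502.03415
[crux] Named fact (unrefereed preprint, imported by name, never proved here): Markman's theorem —
rational (3,3) Weil classes on hyperbolic ℚ(√-d)-Weil sixfolds are algebraic. Crux-kind only because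
every binder of the deciding theorem must be an item. [difficulty: open-problem] -/
@[route_item "route-HodgeConjecture-DoublyPolarisedTransport", crux]
def HyperbolicFloor : Prop :=
  Literature.AlgebraicGeometry.HodgeTheory.Markman2025_weilClasses_algebraic_hyperbolicSixfold

/-- item stmt-HodgeConjecture-23605 · support · rank 6 · open · by planner
why it might fail: only if the tree's typing of IsWeilSimilar is stronger than Deligne's hypothesis (matrix form with a common multiplier); then the fact as typed is not the published one.
sources: doi:10.1007/978-3-540-38955-2_3
[crux] Named refereed fact, imported by name: Deligne's reach by similitude — two polarised
Weil-type abelian varieties with similar rational Hermitian data lie in one connected Weil-type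
family (Mumford 1969 families; Deligne 1982 proof of Thm 4.8). [difficulty: provable-now] -/
@[route_item "route-HodgeConjecture-DoublyPolarisedTransport", crux]
def SimilarReach : Prop :=
  Literature.AlgebraicGeometry.HodgeTheory.weilFamilyReach_similar

/-- item stmt-HodgeConjecture-23606 · support · rank 7 · open · by planner
why it might fail: only a typing risk: the tree's def quantifies over SchemeOver ℂ families with a smoothness hypothesis on the base; a mismatch with door L's use would surface as a type error, not a mathematical gap.
sources: Fulton1998
[crux] Named textbook fact, imported by name: the fibre classes of a flat family of closed
subschemes of a smooth projective family are the restrictions of one class (Fulton 1998 §10.1 /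
Voisin II §9.2); consumed by door L. [difficulty: provable-now] -/
@[route_item "route-HodgeConjecture-DoublyPolarisedTransport", crux]
def FlatClassSpecialises : Prop :=
  Literature.AlgebraicGeometry.HodgeTheory.fulton1998_flatFamily_cycleClass_specialises

/-- item stmt-HodgeConjecture-24412 · aside · rank 9 · open · by planner
[crux] at every real-multiplication doubly-polarised ℚ(√−d)-Weil sixfold anchor (P, ψ₀, ρ, e_F;
(e,a) non-split, (e′,a′) hyperbolic) every nonzero rational (3,3) Weil class w satisfies the local
clause WeilAnchorLocalClause 3 d P h w for h = d·a|_P + ψ₀^*(a|_P). [difficulty: open-problem] -/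
@[route_item "route-HodgeConjecture-DoublyPolarisedTransport"]
def RMAnchorLocalClause : Prop :=
  ∀ d : ℕ, 0 < d → ∀ (P : Literature.AlgebraicGeometry.Motives.AbelianVariety ℂ) (ψ₀ ρ : P ⟶ P) (eF : ℕ) (e e' : Literature.AlgebraicGeometry.Motives.ProjectiveEmbedding P.X) (a : Literature.AlgebraicGeometry.HodgeTheory.complexBetti (Literature.AlgebraicGeometry.Motives.projectiveSpace e.n ℂ) 2) (a' : Literature.AlgebraicGeometry.HodgeTheory.complexBetti (Literature.AlgebraicGeometry.Motives.projectiveSpace e'.n ℂ) 2) (w : Literature.AlgebraicGeometry.HodgeTheory.complexBetti P.X (2 * 3)), P.dim = 2 * 3 → CategoryTheory.CategoryStruct.comp ψ₀ ψ₀ = -(d • CategoryTheory.CategoryStruct.id P) → 0 < eF → ¬ IsSquare eF → CategoryTheory.CategoryStruct.comp ρ ρ = eF • CategoryTheory.CategoryStruct.id P → CategoryTheory.CategoryStruct.comp ρ ψ₀ = CategoryTheory.CategoryStruct.comp ψ₀ ρ → Literature.AlgebraicGeometry.HodgeTheory.IsRationalClass a → a ≠ 0 → Literature.AlgebraicGeometry.HodgeTheory.IsRationalClass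 a' → a' ≠ 0 → w ∈ Literature.AlgebraicGeometry.HodgeTheory.weilClassesOf P ψ₀ 3 d → Literature.AlgebraicGeometry.HodgeTheory.IsRationalClass w → w ≠ 0 → Literature.AlgebraicGeometry.HodgeTheory.IsOfHodgeType (2 * 3) P.X (2 * 3) 3 3 w → Literature.AlgebraicGeometry.Motives.IsHyperbolicWeilType P ψ₀ 3 ((d : ℂ) • Literature.AlgebraicGeometry.HodgeTheory.complexBetti.map e'.ι 2 a' + Literature.AlgebraicGeometry.HodgeTheory.complexBetti.map ψ₀.hom.hom.hom 2 (Literature.AlgebraicGeometry.HodgeTheory.complexBetti.map e'.ι 2 a')) → ¬ Literature.AlgebraicGeometry.Motives.IsHyperbolicWeilType P ψ₀ 3 ((d : ℂ) • Literature.AlgebraicGeometry.HodgeTheory.complexBetti.map e.ι 2 a + Literature.AlgebraicGeometry.HodgeTheory.complexBetti.map ψ₀.hom.hom.hom 2 (Literature.AlgebraicGeometry.HodgeTheory.complexBetti.map e.ι 2 a)) → Literature.AlgebraicGeometry.HodgeTheory.WeilAnchorLocalClause 3 d P ((d : ℂ) • Literature.AlgebraicGeometry.HodgeTheory.complexBetti.map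 e.ι 2 a + Literature.AlgebraicGeometry.HodgeTheory.complexBetti.map ψ₀.hom.hom.hom 2 (Literature.AlgebraicGeometry.HodgeTheory.complexBetti.map e.ι 2 a)) w

/-- item stmt-HodgeConjecture-25190 · support · rank 9 · open · by planner
why it might fail: vG94 §5: det H multiplicative (5.2(3)), Landherr (5.4.1); dim A odd ⇒ the Segre weight on A moves det H onto (−1)^N. Fails only by a typing slip (sign of the symmetrised hyperplane class vs the (N,N) convention of IsOfHodgeType) — shape copied from aimedSplitProduct_cmSquare_of_pos.
sources: vanGeemen1994HodgeAV, Landherr1936HermitianForms, arXiv:2509.23403, arXiv:2502.03415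
[support] F5 of MEMO-negation-g4 (hodge-idea-1 g4; critic idea-crit-6 l.24828 endorsed typing):
ODD-SPLIT PRODUCT ANCHORS ARE HYPERBOLICALLY POLARISABLE — for d ≥ 1 and (A × B, φ × ψ) of Weil type
(N,N) (non-zero rational (N,N) class in its Weil plane) with dim A odd, some weighted Segre
embedding e of A × B and rational a ≠ 0 make the K-symmetrised hyperplane class HYPERBOLIC
(IsHyperbolicWeilType … N): van Geemen 5.2(3) det H multiplicative, the odd factor weight x moves
det H through all of ℚ^×_{>0}/Nm(K^×) onto (−1)^N, Landherr (5.4.1) ⇒ Witt index N. Complement of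
the tree aimed split product Motives.aimedSplitProduct_cmSquare_of_pos (even factors must be AIMED;
here re-weighting suffices). Provable now (size M) from
Motives.isHyperbolicWeilType_prod_of_rationalModels + exists_isotropic_blockVectors′ /
exists_weil_presplitting + meyer_holds + SegreHyperplaneClass +
hodgeRiemann_degreeOne_of_isOfHodgeType + weilMultiplicity_of_mem_weilClassesOf. USE: with
HyperbolicFloor (23604) at N = 3 the Weil classes of every product sixfold anchor E_K × A′₅, B₃ ×
B′₃ (all d, every compatible product polarisation class) are algebraic (glue
weilClasses_algebraic_of_oddSplitProduct checked so -/
@[route_item "route-HodgeConjecture-DoublyPolarisedTransport"]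
def OddSplitProductHyperbolic : Prop :=
  ∀ d : ℕ, 0 < d → ∀ (N : ℕ) (A B : Literature.AlgebraicGeometry.Motives.AbelianVariety ℂ) (φ : A ⟶ A) (ψ : B ⟶ B) (w : Literature.AlgebraicGeometry.HodgeTheory.complexBetti (A.prod B).X (2 * N)), (A.prod B).dim = 2 * N → Odd A.dim → CategoryTheory.CategoryStruct.comp φ φ = -(d • CategoryTheory.CategoryStruct.id A) → CategoryTheory.CategoryStruct.comp ψ ψ = -(d • CategoryTheory.CategoryStruct.id B) → w ∈ Literature.AlgebraicGeometry.HodgeTheory.weilClassesOf (A.prod B) (Literature.AlgebraicGeometry.Motives.AbelianVariety.prodLift (CategoryTheory.CategoryStruct.comp (Literature.AlgebraicGeometry.Motives.AbelianVariety.fst A B) φ) (CategoryTheory.CategoryStruct.comp (Literature.AlgebraicGeometry.Motives.AbelianVariety.snd A B) ψ)) N d → Literature.AlgebraicGeometry.HodgeTheory.IsRationalClass w → w ≠ 0 → Literature.AlgebraicGeometry.HodgeTheory.IsOfHodgeType (2 * N) (A.prod B).X (2 * N) N N w → ∃ (e : Literature.AlgebraicGeometry.Motives.ProjectiveEmbedding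 (A.prod B).X) (a : Literature.AlgebraicGeometry.HodgeTheory.complexBetti (Literature.AlgebraicGeometry.Motives.projectiveSpace e.n ℂ) 2), Literature.AlgebraicGeometry.HodgeTheory.IsRationalClass a ∧ a ≠ 0 ∧ Literature.AlgebraicGeometry.Motives.IsHyperbolicWeilType (A.prod B) (Literature.AlgebraicGeometry.Motives.AbelianVariety.prodLift (CategoryTheory.CategoryStruct.comp (Literature.AlgebraicGeometry.Motives.AbelianVariety.fst A B) φ) (CategoryTheory.CategoryStruct.comp (Literature.AlgebraicGeometry.Motives.AbelianVariety.snd A B) ψ)) N ((d : ℂ) • Literature.AlgebraicGeometry.HodgeTheory.complexBetti.map e.ι 2 a + Literature.AlgebraicGeometry.HodgeTheory.complexBetti.map (Literature.AlgebraicGeometry.Motives.AbelianVariety.prodLift (CategoryTheory.CategoryStruct.comp (Literature.AlgebraicGeometry.Motives.AbelianVariety.fst A B) φ) (CategoryTheory.CategoryStruct.comp (Literature.AlgebraicGeometry.Motives.AbelianVariety.snd A B) ψ)).hom.hom.hom 2 (Literature.AlgebraicGeometry.HodgeTheory.complexBetti.map e.ι 2 a))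

/-- item stmt-HodgeConjecture-23607 · assembly · rank 1 · open · by planner
sources: Deligne1982HodgeCycles, Artin1969
[assembly] DoublyPolarisedLiftableCarriers → DoublyPolarisedSimilarAnchors → HyperbolicFloor →
SimilarReach → FlatClassSpecialises → WeilSixfolds (rung H2). -/
@[route_item "route-HodgeConjecture-DoublyPolarisedTransport"]
def Assembly : Prop :=
  DoublyPolarisedLiftableCarriers → DoublyPolarisedSimilarAnchors → HyperbolicFloor → SimilarReach → FlatClassSpecialises → Summit.HodgeConjecture.HodgeConjecture.Theses.SevenfoldWeilCensus.WeilSixfolds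

/-! D-0027 §2.1 — DECIDING THEOREM (planner-authored via `route open/edit --closes-file`; by planner-hodge-idea-1-g2-0 2026-08-27T23:23:49Z):
its hypotheses are this route's items and its conclusion the registered leaf `Summit.HodgeConjecture.HodgeConjecture.Theses.SevenfoldWeilCensus.WeilSixfolds` (rung H2, D-0061) (glue_lint), and it elaborates with this file. -/

@[closes "route-HodgeConjecture-DoublyPolarisedTransport"] theorem closes (h₁ : DoublyPolarisedLiftableCarriers) (h₂ : DoublyPolarisedSimilarAnchors) (h₃ : HyperbolicFloor)
    (h₄ : SimilarReach) (h₅ : FlatClassSpecialises) :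
    Summit.HodgeConjecture.HodgeConjecture.Theses.SevenfoldWeilCensus.WeilSixfolds :=
  Summit.HodgeConjecture.HodgeConjecture.WeilTypeLadder.weilSixfolds_of_floor_of_reachSimilar_of_similarAnchorsAwayFromSplit
    h₃ h₄ (fun d hd A φ hA hφ hnh hwA => by
      obtain ⟨eA, aA, P, ψ₀, e, e', a, a', w, haA, haA0, hP, hψ, ha, ha0, ha', ha'0, hwW, hwrat, hw0, hwH, hhyp,
        hnhyp, hsim⟩ := h₂ d hd A φ hA hφ hnh hwA
      obtain ⟨Z, κ, q, hκ, hint, hcoh, hcohp, hsupp, hL⟩ :=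
        h₁ d hd P ψ₀ e e' a a' w hP hψ ha ha0 ha' ha'0 hwW hwrat hw0 hwH hhyp hnhyp
      exact ⟨eA, aA, P, ψ₀, e, a, w, haA, haA0, hP, hψ, ha, ha0, hwW, hwrat, hw0, hwH,
        Summit.HodgeConjecture.HodgeConjecture.Theorems.BlochSeedDiscThree.weilAnchorLocalClause_of_liftsAlongWeilFamilies
          h₅ hκ hint hcoh hcohp hsupp hL, hsim⟩)

end Summit.HodgeConjecture.HodgeConjecture.Theses.DoublyPolarisedTransport
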